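import Summits.MatrixMultiplication.MatrixMultiplication.Theorems.AbelianSTPPCensusLeafTC3192Closed
import Summits.MatrixMultiplication.MatrixMultiplication.Theorems.AbelianSTPPCensusTCWall3193

/-!
# T_C: the static-certificate hypotheses vM ∪ U11-G ∪ E3 exclude beating `2.4` exactly up to order 3192

Cell mm-stpp (rung F-M1), tier T_C = «beat `2.4`»; seat mm-stpp-vp-p2 (gen 6).  Bookkeeping conjunction of two landed kernel facts, stated once so that
the census can cite ONE declaration for «T_C is closed for the hypothesis set»: (a) `TC3Stat.not_beats_240` (`AbelianSTPPCensusLeafTC3192Closed.lean`,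
multi-parameter k-member tree): at every order `3004 ≤ M ≤ 3192` no shape list with ≥ 2 members that is `SieveAdmissible M ∧ U11G M ∧ TAKnap575.E3Adm M`
beats `12/5` (the orders `≤ 3003` are the earlier leaves); (b) `TCWall.tcStaticHypotheses_hold_at_3193` (`AbelianSTPPCensusTCWall3193.lean`): at `M = 3193`
such a list exists (`(12,12,13)⁶ + (12,12,12) + (11,11,11)`).  Hence no certificate whose only inputs are these three rule families can move the T_C
kernel column beyond `3192`, and `3192` is attained (`noAbelianSTPPHostUpTo_240_3192`).
WHAT THIS IS NOT: no existence claim for an STPP family at order 3193 (the list is rule-admissible only); no `ω` statement; nothing about other tiers.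
-/

set_option linter.dupNamespace false
set_option autoImplicit false

namespace Summit.MatrixMultiplication.MatrixMultiplication.Theorems

/-- **T_C static certificate, both ends.**  vM ∪ U11-G ∪ E3 exclude beating `12/5` at every order `3004 … 3192`, and admit a beating list at `3193`. [original] -/
theorem tcStaticCertificate_exact_3192 :
    (∀ (N M : ℕ) (a b c : Fin N → ℕ), 2 ≤ N → 3004 ≤ M → M ≤ 3192 →
        SieveAdmissible M a b c → U11G M a b c → TAKnap575.E3Adm M a b c → ¬ Beats (12 / 5) M a b c) ∧
      (∃ (a b c : Fin 8 → ℕ), SieveAdmissible 3193 a b c ∧ U11G 3193 a b c ∧ TAKnap575.E3Adm 3193 a b c ∧ Beats (12 / 5) 3193 a b c) :=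
  ⟨TC3Stat.not_beats_240, TCWall.tcStaticHypotheses_hold_at_3193⟩

/-- **T_C/3192 with its wall**: no abelian STPP host of order `≤ 3192` beats `2.4` (kernel), while the hypothesis set of every landed T_C certificate is
satisfied by a beating list at `3193`. [original] -/
theorem noAbelianSTPPHostUpTo_240_3192_and_wall :
    NoAbelianSTPPHostUpTo (12 / 5) 3192 ∧
      (∃ (a b c : Fin 8 → ℕ), SieveAdmissible 3193 a b c ∧ U11G 3193 a b c ∧ TAKnap575.E3Adm 3193 a b c ∧ Beats (12 / 5) 3193 a b c) :=
  ⟨noAbelianSTPPHostUpTo_240_3192, TCWall.tcStaticHypotheses_hold_at_3193⟩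

end Summit.MatrixMultiplication.MatrixMultiplication.Theorems
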